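import Summits.Ventures.HSemireg.WedgeModelCoord

/-!
# Venture HSemireg — THEOREM K_lin: Künneth multiplicativity of wedge ranks (sign-free)

HONEST FRAMING. Part of the Lean index of the computation cell `pub-hsemireg` (seat p3; Sunday enclosure of the
FORMULA-N kernel assets of seats th-7 / th-6, ENCLOSURE-PLAN-p3.md).  Finite-dimensional exterior algebra over a field ONLY:
no variety, no cohomology theory, no semiregularity map is constructed here; nothing here says that HC / HC_CM / HC_AV holds;
no Literature fact is declared or used.  The geometric DICTIONARY (why these ranks are the `HT`-side box ranks of the cell's
STRUCTURE.md §1 / theory/FORMULA-N.md) lives in theory/FORMULA-N-th7.md PART B §A.3 / §N and is NOT asserted in Lean.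

THEOREM K_lin (FORMULA-N PART A §2.3 THEOREM K «Künneth multiplicativity», PART B §N.3 / §N.7 (a)) in the sign-free wedge model
(th-7 KunnethRank.lean v3 l.355–701): for generators `I` split into disjoint blocks `D₁ ⊔ D₂` and HOMOGENEOUS classes `f₁ ∈ Hom D₁ d₁`,
`f₂ ∈ Hom D₂ d₂`, the factor rank spaces `V D f i := span{E_s ∧ f : s ⊆ D, |s| = i}` satisfy the SELF-ITERATING block form
`finrank_V_mul : dim V_{D₁⊔D₂}(f₁f₂, k) = Σ_{i ≤ k} dim V_{D₁}(f₁, i) · dim V_{D₂}(f₂, k−i)`, hence the rank statement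
`finrank_range_wedge_mul` for `θ ↦ θ ∧ (f₁ ∧ f₂)` on `⋀^k` when `D₁ ⊔ D₂ = univ`, the polynomial identity `rankPoly_mul`
(«rank polynomials multiply», FORMULA-N Σ2 verbatim), and the block-embedding glue (`emb φ` along an order embedding `φ : J ↪o I`
is injective and `finrank_V_emb` identifies the factor rank in the big algebra with the intrinsic rank).  No permutation sign is ever
evaluated.  th-7's statements and proofs, unchanged (namespace `HSemiregKunneth` ↦ `Summit.Ventures.HSemireg.Wedge.Kunneth`; the
infrastructure it shares with the Hankel law is imported from `WedgeModel*.lean`).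
-/

open Module Set Set.powersetCard

namespace Summit.Ventures.HSemireg.Wedge.Kunneth

variable (K : Type*) [Field K] (I : Type*) [LinearOrder I] [Fintype I]

/-- `V D f i` = span{E_s ∧ f : s ⊆ D, |s| = i}; its dimension is the «factor rank» `r_i(f)`. -/
noncomputable def V (D : Finset I) (f : HT K I) (i : ℕ) : Submodule K (HT K I) :=
  Submodule.span K ((fun s => B K I s * f) '' {s | s ⊆ D ∧ s.card = i})

/-- `θ ↦ θ ∧ x` on `⋀^k`. -/
noncomputable def wedge (k : ℕ) (x : HT K I) : (⋀[K]^k (I → K)) →ₗ[K] HT K I :=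
  (LinearMap.mulRight K x) ∘ₗ (⋀[K]^k (I → K)).subtype

variable {I}

/-- `⋀^k` is the span of the monomials of cardinality `k`. -/
lemma exteriorPower_eq_span (k : ℕ) :
    (⋀[K]^k (I → K) : Submodule K (HT K I)) =
      Submodule.span K ((fun s => B K I s) '' {s | s.card = k}) := by
  have h1 : (⋀[K]^k (I → K) : Submodule K (HT K I)) = Submodule.map (⋀[K]^k (I → K)).subtype ⊤ := by simp
  rw [h1, ← ((b K I).exteriorPower k).span_eq, Submodule.map_span, ← Set.range_comp]
  congr 1
  ext x
  simp only [Set.mem_range, Function.comp_apply, Set.mem_image, Set.mem_setOf_eq]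
  constructor
  · rintro ⟨s, rfl⟩
    refine ⟨s, card_eq s, ?_⟩
    simp [B, ExteriorAlgebra.basis_eq_coe_basis]
  · rintro ⟨s, hs, rfl⟩
    exact ⟨⟨s, by rw [mem_iff, hs]⟩,
      (ExteriorAlgebra.basis_eq_coe_basis (b K I) (⟨s, by rw [mem_iff, hs]⟩ : powersetCard I k)).symm⟩

/-- the range of `θ ↦ θ ∧ x` on `⋀^k` is spanned by the `E_s ∧ x`, `|s| = k`. -/
lemma range_wedge (k : ℕ) (x : HT K I) :
    LinearMap.range (wedge K I k x) = Submodule.span K ((fun s => B K I s * x) '' {s | s.card = k}) := by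
  rw [wedge, LinearMap.range_comp, Submodule.range_subtype, exteriorPower_eq_span, Submodule.map_span,
    Set.image_image]
  rfl

/-- `V D f i ≤ Hom D (i + d)` for `f` homogeneous of degree `d` on `D`. -/
lemma V_le_Hom {D : Finset I} {d : ℕ} {f : HT K I} (hf : f ∈ Hom K I D d) (i : ℕ) :
    V K I D f i ≤ Hom K I D (i + d) := by
  rw [V, Submodule.span_le]
  rintro _ ⟨s, ⟨hs, hc⟩, rfl⟩
  rw [SetLike.mem_coe, ← hc]
  exact B_mul_mem_Hom K hs hf

/-- the product formula for one monomial: `E_s ∧ (f₁ f₂) = unit • (E_{s∩D₁} ∧ f₁)(E_{s∩D₂} ∧ f₂)`. -/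
lemma B_mul_mul {D₁ D₂ : Finset I} (hD : Disjoint D₁ D₂) {d₁ : ℕ}
    {f₁ : HT K I} (hf₁ : f₁ ∈ Hom K I D₁ d₁) (f₂ : HT K I) {s : Finset I} (hsD : s ⊆ D₁ ∪ D₂) :
    B K I s * (f₁ * f₂) =
      ((u K (s ∩ D₁) (s ∩ D₂))⁻¹ * (-1 : K) ^ ((s ∩ D₂).card * d₁)) •
        ((B K I (s ∩ D₁) * f₁) * (B K I (s ∩ D₂) * f₂)) := by
  have hs : s = s ∩ D₁ ∪ s ∩ D₂ := by
    rw [← Finset.inter_union_distrib_left, Finset.inter_eq_left.mpr hsD]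
  have hdisj : Disjoint (s ∩ D₁) (s ∩ D₂) :=
    disjoint_of_subsets hD Finset.inter_subset_right Finset.inter_subset_right
  have hB : B K I s = (u K (s ∩ D₁) (s ∩ D₂))⁻¹ • (B K I (s ∩ D₁) * B K I (s ∩ D₂)) := by
    rw [B_mul_B, smul_smul, inv_mul_cancel₀ ((u_ne_zero_iff K).mpr hdisj), one_smul, ← hs]
  rw [hB, smul_mul_assoc, mul_assoc, ← mul_assoc (B K I (s ∩ D₂)), B_mul_comm_of_mem_Hom K hf₁,
    smul_mul_assoc, mul_smul_comm, smul_smul, mul_assoc, mul_assoc]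

/-- **THEOREM K_lin, block form (self-iterating): Künneth multiplicativity of the factor rank spaces.**
For disjoint blocks `D₁, D₂` and homogeneous `f₁ ∈ Hom D₁ d₁`, `f₂ ∈ Hom D₂ d₂`:
`dim V_{D₁ ⊔ D₂}(f₁f₂, k) = Σ_{i=0}^{k} dim V_{D₁}(f₁, i) · dim V_{D₂}(f₂, k − i)`. -/
theorem finrank_V_mul {D₁ D₂ : Finset I} (hD : Disjoint D₁ D₂)
    {d₁ d₂ : ℕ} {f₁ f₂ : HT K I} (hf₁ : f₁ ∈ Hom K I D₁ d₁) (hf₂ : f₂ ∈ Hom K I D₂ d₂) (k : ℕ) :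
    Module.finrank K (V K I (D₁ ∪ D₂) (f₁ * f₂) k) =
      ∑ i ∈ Finset.range (k + 1),
        Module.finrank K (V K I D₁ f₁ i) * Module.finrank K (V K I D₂ f₂ (k - i)) := by
  classical
  -- bases of the factor rank spaces
  let Vi : Fin (k + 1) → Submodule K (HT K I) := fun i => V K I D₁ f₁ i
  let Wi : Fin (k + 1) → Submodule K (HT K I) := fun i => V K I D₂ f₂ (k - i)
  let bV := fun i => Module.Free.chooseBasis K (Vi i)
  let bW := fun i => Module.Free.chooseBasis K (Wi i)
  let v : (i : Fin (k + 1)) → Module.Free.ChooseBasisIndex K (Vi i) → HT K I := fun i α => (bV i α : HT K I)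
  let w : (i : Fin (k + 1)) → Module.Free.ChooseBasisIndex K (Wi i) → HT K I := fun i β => (bW i β : HT K I)
  have hv : ∀ (i : Fin (k + 1)) α, v i α ∈ Hom K I D₁ ((i : ℕ) + d₁) :=
    fun i α => V_le_Hom K hf₁ i (bV i α).2
  have hw : ∀ (i : Fin (k + 1)) β, w i β ∈ Hom K I D₂ ((k - i) + d₂) :=
    fun i β => V_le_Hom K hf₂ (k - i) (bW i β).2
  have hvli : ∀ i, LinearIndependent K (v i) := fun i =>
    (bV i).linearIndependent.map' (Vi i).subtype (Submodule.ker_subtype _)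
  have hwli : ∀ i, LinearIndependent K (w i) := fun i =>
    (bW i).linearIndependent.map' (Wi i).subtype (Submodule.ker_subtype _)
  have hli := linearIndependent_mul K hD (m := k + 1) (fun i => (i : ℕ) + d₁) (fun i => (k - i) + d₂)
    (fun i j h => Fin.ext (by simpa using h)) v w hv hw hvli hwli
  -- the spans of the bases
  have hVspan : ∀ i, (Vi i : Submodule K (HT K I)) = Submodule.span K (Set.range (v i)) := by
    intro i
    conv_lhs => rw [← Submodule.map_subtype_top (Vi i), ← (bV i).span_eq, Submodule.map_span]
    congr 1
    ext x
    simp only [Set.mem_image, Set.mem_range]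
    constructor
    · rintro ⟨y, ⟨α, rfl⟩, rfl⟩; exact ⟨α, rfl⟩
    · rintro ⟨α, rfl⟩; exact ⟨bV i α, ⟨α, rfl⟩, rfl⟩
  have hWspan : ∀ i, (Wi i : Submodule K (HT K I)) = Submodule.span K (Set.range (w i)) := by
    intro i
    conv_lhs => rw [← Submodule.map_subtype_top (Wi i), ← (bW i).span_eq, Submodule.map_span]
    congr 1
    ext x
    simp only [Set.mem_image, Set.mem_range]
    constructor
    · rintro ⟨y, ⟨α, rfl⟩, rfl⟩; exact ⟨α, rfl⟩
    · rintro ⟨α, rfl⟩; exact ⟨bW i α, ⟨α, rfl⟩, rfl⟩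
  -- the product rank space is the span of the products
  have hrange : V K I (D₁ ∪ D₂) (f₁ * f₂) k =
      Submodule.span K (Set.range fun x : (Σ i, Module.Free.ChooseBasisIndex K (Vi i) ×
        Module.Free.ChooseBasisIndex K (Wi i)) => v x.1 x.2.1 * w x.1 x.2.2) := by
    apply le_antisymm
    · rw [V, Submodule.span_le]
      rintro _ ⟨s, ⟨hsD, hs⟩, rfl⟩
      rw [SetLike.mem_coe]
      show B K I s * (f₁ * f₂) ∈ _
      rw [B_mul_mul K hD hf₁ f₂ hsD]
      apply Submodule.smul_mem
      -- degrees
      have hcard : (s ∩ D₁).card + (s ∩ D₂).card = k := by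
        rw [← Finset.card_union_of_disjoint (disjoint_of_subsets hD Finset.inter_subset_right
          Finset.inter_subset_right), ← Finset.inter_union_distrib_left, Finset.inter_eq_left.mpr hsD, hs]
      have hi : (s ∩ D₁).card < k + 1 := by omega
      let i : Fin (k + 1) := ⟨(s ∩ D₁).card, hi⟩
      have h1 : B K I (s ∩ D₁) * f₁ ∈ Submodule.span K (Set.range (v i)) := by
        rw [← hVspan]
        exact Submodule.subset_span ⟨s ∩ D₁, ⟨Finset.inter_subset_right, rfl⟩, rfl⟩
      have h2 : B K I (s ∩ D₂) * f₂ ∈ Submodule.span K (Set.range (w i)) := by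
        rw [← hWspan]
        refine Submodule.subset_span ⟨s ∩ D₂, ⟨Finset.inter_subset_right, ?_⟩, rfl⟩
        show (s ∩ D₂).card = k - (s ∩ D₁).card
        omega
      have h12 := Submodule.mul_mem_mul h1 h2
      rw [Submodule.span_mul_span] at h12
      refine Submodule.span_mono ?_ h12
      rintro _ ⟨a, ⟨α, rfl⟩, c, ⟨β, rfl⟩, rfl⟩
      exact ⟨⟨i, (α, β)⟩, rfl⟩
    · rw [Submodule.span_le]
      rintro _ ⟨⟨i, α, β⟩, rfl⟩
      rw [SetLike.mem_coe]
      -- v i α * w i β ∈ V_i * W_i ⊆ range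
      have h1 : v i α ∈ Vi i := (bV i α).2
      have h2 : w i β ∈ Wi i := (bW i β).2
      have h12 : v i α * w i β ∈ Vi i * Wi i := Submodule.mul_mem_mul h1 h2
      have hle : Vi i * Wi i ≤ V K I (D₁ ∪ D₂) (f₁ * f₂) k := by
        change V K I D₁ f₁ i * V K I D₂ f₂ (k - i) ≤ _
        rw [V, V, Submodule.span_mul_span, Submodule.span_le, V]
        rintro _ ⟨_, ⟨s₁, ⟨hs₁, hc₁⟩, rfl⟩, _, ⟨s₂, ⟨hs₂, hc₂⟩, rfl⟩, rfl⟩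
        rw [SetLike.mem_coe]
        show (B K I s₁ * f₁) * (B K I s₂ * f₂) ∈ _
        -- (B s₁ f₁)(B s₂ f₂) = ± u • B(s₁ ∪ s₂) (f₁ f₂)
        have hdisj : Disjoint s₁ s₂ := disjoint_of_subsets hD hs₁ hs₂
        have heq : (B K I s₁ * f₁) * (B K I s₂ * f₂) =
            ((-1 : K) ^ (s₂.card * d₁) * u K s₁ s₂) • (B K I (s₁ ∪ s₂) * (f₁ * f₂)) := by
          rw [mul_assoc, ← mul_assoc f₁, show f₁ * B K I s₂ = ((-1 : K) ^ (s₂.card * d₁)) • (B K I s₂ * f₁) from ?_,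
            smul_mul_assoc, mul_smul_comm, mul_assoc, ← mul_assoc (B K I s₁), B_mul_B, smul_mul_assoc,
            smul_smul]
          -- f₁ * B s₂ = (-1)^(|s₂| d₁) • (B s₂ * f₁) from the parity law
          have h := B_mul_comm_of_mem_Hom K hf₁ s₂
          rw [h, smul_smul, ← pow_add, ← two_mul, pow_mul, neg_one_sq, one_pow, one_smul]
        rw [heq]
        apply Submodule.smul_mem
        apply Submodule.subset_span
        refine ⟨s₁ ∪ s₂, ⟨Finset.union_subset_union hs₁ hs₂, ?_⟩, rfl⟩
        show (s₁ ∪ s₂).card = k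
        rw [Finset.card_union_of_disjoint hdisj, hc₁, hc₂]
        have := i.2
        omega
      exact hle h12
  -- count
  rw [hrange, finrank_span_eq_card hli, Fintype.card_sigma]
  simp_rw [Fintype.card_prod]
  rw [Finset.sum_range]
  refine Finset.sum_congr rfl fun i _ => ?_
  rw [Module.finrank_eq_card_chooseBasisIndex, Module.finrank_eq_card_chooseBasisIndex]

/-- the full-rank space is the range of the wedge map: `V univ f k = range (θ ↦ θ ∧ f on ⋀^k)`. -/
lemma V_univ (f : HT K I) (k : ℕ) : V K I Finset.univ f k = LinearMap.range (wedge K I k f) := by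
  rw [range_wedge, V]
  congr 1
  ext x
  simp

/-- **THEOREM K_lin (Künneth multiplicativity of wedge ranks), sign-free wedge model.**
For `I = D₁ ⊔ D₂` and homogeneous `f₁ ∈ Hom D₁ d₁`, `f₂ ∈ Hom D₂ d₂`:
`rank(θ ↦ θ ∧ f₁f₂ on ⋀^k) = Σ_{i=0}^{k} r_i(f₁) · r_{k−i}(f₂)` with `r_i(f) = dim span{E_s ∧ f : s ⊆ D, |s| = i}`. -/
theorem finrank_range_wedge_mul {D₁ D₂ : Finset I} (hD : Disjoint D₁ D₂) (hcov : D₁ ∪ D₂ = Finset.univ)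
    {d₁ d₂ : ℕ} {f₁ f₂ : HT K I} (hf₁ : f₁ ∈ Hom K I D₁ d₁) (hf₂ : f₂ ∈ Hom K I D₂ d₂) (k : ℕ) :
    Module.finrank K (LinearMap.range (wedge K I k (f₁ * f₂))) =
      ∑ i ∈ Finset.range (k + 1),
        Module.finrank K (V K I D₁ f₁ i) * Module.finrank K (V K I D₂ f₂ (k - i)) := by
  rw [← V_univ, ← hcov]
  exact finrank_V_mul K hD hf₁ hf₂ k

/-- closure: the product of block-supported homogeneous classes is homogeneous on the union block
(so the block form iterates over any finite splitting). -/
lemma mul_mem_Hom {D₁ D₂ : Finset I} (hD : Disjoint D₁ D₂) {d₁ d₂ : ℕ} {f₁ f₂ : HT K I}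
    (hf₁ : f₁ ∈ Hom K I D₁ d₁) (hf₂ : f₂ ∈ Hom K I D₂ d₂) : f₁ * f₂ ∈ Hom K I (D₁ ∪ D₂) (d₁ + d₂) := by
  induction hf₁, hf₂ using Submodule.span_induction₂ with
  | mem_mem x y hx hy =>
    obtain ⟨a, ha, rfl⟩ := hx
    obtain ⟨c, hc, rfl⟩ := hy
    rw [B_mul_B]
    refine Submodule.smul_mem _ _ (B_mem_Hom K (Finset.union_subset_union ha.1 hc.1) ?_)
    rw [Finset.card_union_of_disjoint (disjoint_of_subsets hD ha.1 hc.1), ha.2, hc.2]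
  | zero_left y _ => rw [zero_mul]; exact Submodule.zero_mem _
  | zero_right x _ => rw [mul_zero]; exact Submodule.zero_mem _
  | add_left x y z _ _ _ hx hy => rw [add_mul]; exact Submodule.add_mem _ hx hy
  | add_right x y z _ _ _ hx hy => rw [mul_add]; exact Submodule.add_mem _ hx hy
  | smul_left r x y _ _ hx => rw [smul_mul_assoc]; exact Submodule.smul_mem _ _ hx
  | smul_right r x y _ _ hx => rw [mul_smul_comm]; exact Submodule.smul_mem _ _ hx

/-! ### «Rank polynomials multiply» -/

/-- `V D f i = ⊥` once `i` exceeds the number of generators. -/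
lemma V_eq_bot_of_lt {D : Finset I} {f : HT K I} {i : ℕ} (hi : Fintype.card I < i) : V K I D f i = ⊥ := by
  rw [V, Submodule.span_eq_bot]
  rintro _ ⟨s, ⟨-, hs⟩, rfl⟩
  exfalso
  have := s.card_le_univ
  omega

variable (I)

/-- the RANK POLYNOMIAL of a block-supported class: `P_{D,f}(t) = Σ_i dim V_D(f,i) t^i`. -/
noncomputable def rankPoly (D : Finset I) (f : HT K I) : Polynomial ℕ :=
  ∑ i ∈ Finset.range (Fintype.card I + 1), Polynomial.monomial i (Module.finrank K (V K I D f i))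

variable {I}

/-- the `k`-th coefficient of the rank polynomial is `dim V D f k`. -/
lemma coeff_rankPoly (D : Finset I) (f : HT K I) (k : ℕ) :
    (rankPoly K I D f).coeff k = Module.finrank K (V K I D f k) := by
  rw [rankPoly, Polynomial.finsetSum_coeff]
  simp_rw [Polynomial.coeff_monomial]
  rw [Finset.sum_ite_eq']
  split_ifs with h
  · rfl
  · rw [Finset.mem_range, not_lt] at h
    rw [V_eq_bot_of_lt K (by omega), finrank_bot]

/-- **THEOREM K_lin, polynomial form: RANK POLYNOMIALS MULTIPLY.**
`P_{D₁⊔D₂, f₁f₂}(t) = P_{D₁,f₁}(t) · P_{D₂,f₂}(t)` for disjoint blocks and homogeneous block-supported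
classes (FORMULA-N Σ2: `P_box = Π P_factors`; iterate with `mul_mem_Hom`). -/
theorem rankPoly_mul {D₁ D₂ : Finset I} (hD : Disjoint D₁ D₂) {d₁ d₂ : ℕ} {f₁ f₂ : HT K I}
    (hf₁ : f₁ ∈ Hom K I D₁ d₁) (hf₂ : f₂ ∈ Hom K I D₂ d₂) :
    rankPoly K I (D₁ ∪ D₂) (f₁ * f₂) = rankPoly K I D₁ f₁ * rankPoly K I D₂ f₂ := by
  ext k
  rw [coeff_rankPoly, finrank_V_mul K hD hf₁ hf₂ k, Polynomial.coeff_mul,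
    Finset.Nat.sum_antidiagonal_eq_sum_range_succ
      (fun i j => (rankPoly K I D₁ f₁).coeff i * (rankPoly K I D₂ f₂).coeff j) k]
  simp_rw [coeff_rankPoly]

/-! ### Block embeddings: the factor rank space of an embedded class is its intrinsic wedge rank -/

omit [Fintype I] in
/-- `orderEmbOfFin` enumerates a Finset as its sorted list. -/
lemma ofFn_orderEmbOfFin (s : Finset I) {k : ℕ} (h : s.card = k) :
    List.ofFn (fun i => s.orderEmbOfFin h i) = s.sort (· ≤ ·) := by
  apply List.ext_getElem
  · rw [List.length_ofFn, Finset.length_sort, h]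
  · intro i h1 h2
    rw [List.getElem_ofFn, Finset.orderEmbOfFin_apply]
    simp only [Fin.getElem_fin]

omit [Fintype I] in
/-- Mathlib's `ofFinEmbEquiv.symm (pc s)` enumerates `s` as its sorted list. -/
lemma ofFn_enum (s : Finset I) :
    List.ofFn (fun i => (ofFinEmbEquiv.symm (pc s)) i) = s.sort (· ≤ ·) := by
  rw [Set.powersetCard.ofFinEmbEquiv_symm_apply]
  exact ofFn_orderEmbOfFin s _

section Embedding

variable {J : Type*} [LinearOrder J] [Fintype J] (φ : J ↪o I)

/-- extension by zero along `φ` on generators. -/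
noncomputable def L : (J → K) →ₗ[K] (I → K) := (b K J).constr K (fun j => b K I (φ j))

/-- the extension-by-zero map sends the basis vector `b j` to `b (φ j)`. -/
lemma L_b (j : J) : L K φ (b K J j) = b K I (φ j) := by
  rw [L, Basis.constr_basis]

/-- the block embedding of exterior algebras induced by `φ`. -/
noncomputable def emb : HT K J →ₐ[K] HT K I := ExteriorAlgebra.map (L K φ)

/-- the block embedding of exterior algebras is injective (explicit left inverse). -/
lemma emb_injective : Function.Injective (emb K φ) := by
  classical
  apply ExteriorAlgebra.map_injective
  refine ⟨(b K I).constr K (fun i => if h : ∃ j, φ j = i then b K J h.choose else 0), ?_⟩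
  apply (b K J).ext
  intro j
  rw [LinearMap.comp_apply, L_b, Basis.constr_basis, LinearMap.id_apply]
  have h : ∃ j', φ j' = φ j := ⟨j, rfl⟩
  rw [dif_pos h, φ.injective h.choose_spec]

/-- the block embedding sends monomials to monomials. -/
lemma emb_B (s : Finset J) : emb K φ (B K J s) = B K I (s.map φ.toEmbedding) := by
  have h1 : ∀ (l : List (J → K)), emb K φ ((l.map (ExteriorAlgebra.ι K)).prod) =
      ((l.map (L K φ)).map (ExteriorAlgebra.ι K)).prod := by
    intro l
    rw [map_list_prod, List.map_map, List.map_map]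
    congr 1
    apply List.map_congr_left
    intro x _
    simp [emb, ExteriorAlgebra.map_apply_ι]
  rw [B_eq_ιprod K s, h1, List.map_ofFn, B_eq_ιprod K (s.map φ.toEmbedding)]
  have h2 : (L K φ) ∘ ((b K J) ∘ (fun i => (ofFinEmbEquiv.symm (pc s)) i)) =
      (b K I) ∘ (φ ∘ (fun i => (ofFinEmbEquiv.symm (pc s)) i)) := funext fun i => L_b K φ _
  have h3 : List.ofFn (φ ∘ (fun i => (ofFinEmbEquiv.symm (pc s)) i)) =
      List.ofFn (fun i => (ofFinEmbEquiv.symm (pc (s.map φ.toEmbedding))) i) := by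
    rw [← List.map_ofFn, ofFn_enum, ofFn_enum]
    exact (φ.strictMono.strictMonoOn _).map_finsetSort
  have h4 := congrArg (List.map (b K I)) h3
  rw [List.map_ofFn, List.map_ofFn, ← h2] at h4
  exact congrArg (fun l : List (I → K) => (l.map (ExteriorAlgebra.ι K)).prod) h4

/-- the image of the intrinsic wedge range is the factor rank space of the embedded class. -/
lemma map_emb_range_wedge (f₀ : HT K J) (k : ℕ) :
    (LinearMap.range (wedge K J k f₀)).map (emb K φ).toLinearMap =
      V K I (Finset.univ.map φ.toEmbedding) (emb K φ f₀) k := by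
  rw [range_wedge, Submodule.map_span, V]
  congr 1
  ext x
  simp only [Set.mem_image, Set.mem_setOf_eq]
  constructor
  · rintro ⟨_, ⟨s, hs, rfl⟩, rfl⟩
    refine ⟨s.map φ.toEmbedding, ⟨Finset.map_subset_map.mpr (Finset.subset_univ s),
      by rw [Finset.card_map, hs]⟩, ?_⟩
    rw [AlgHom.toLinearMap_apply, map_mul, emb_B]
  · rintro ⟨t, ⟨ht, hc⟩, rfl⟩
    obtain ⟨s, -, rfl⟩ := Finset.subset_map_iff.mp ht
    refine ⟨B K J s * f₀, ⟨s, by rwa [Finset.card_map] at hc, rfl⟩, ?_⟩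
    rw [AlgHom.toLinearMap_apply, map_mul, emb_B]

/-- **GLUE**: the factor rank space of an embedded class has the dimension of its INTRINSIC wedge rank
(so concrete factor laws proved in the block's own exterior algebra — e.g. the point-pair law
`2C(n,k) − [k=0] − [k=n]` of PointPairRank.lean — feed `finrank_V_mul` / `rankPoly_mul`). -/
theorem finrank_V_emb (f₀ : HT K J) (k : ℕ) :
    Module.finrank K (V K I (Finset.univ.map φ.toEmbedding) (emb K φ f₀) k) =
      Module.finrank K (LinearMap.range (wedge K J k f₀)) := by
  rw [← map_emb_range_wedge]
  exact (Submodule.equivMapOfInjective _ (emb_injective K φ) _).finrank_eq.symm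

/-- the embedded class of a homogeneous class is homogeneous on the image block. -/
lemma emb_mem_Hom {f₀ : HT K J} {d : ℕ} (hf : f₀ ∈ Hom K J Finset.univ d) :
    emb K φ f₀ ∈ Hom K I (Finset.univ.map φ.toEmbedding) d := by
  have hle : (Hom K J Finset.univ d).map (emb K φ).toLinearMap ≤
      Hom K I (Finset.univ.map φ.toEmbedding) d := by
    rw [Hom, Submodule.map_span, Submodule.span_le]
    rintro _ ⟨_, ⟨s, hs, rfl⟩, rfl⟩
    rw [SetLike.mem_coe, AlgHom.toLinearMap_apply, emb_B]
    exact B_mem_Hom K (Finset.map_subset_map.mpr (Finset.subset_univ s))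
      (by rw [Finset.card_map]; exact hs.2)
  exact hle ⟨f₀, hf, rfl⟩

end Embedding

end Summit.Ventures.HSemireg.Wedge.Kunneth
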